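import Summits.ResolutionOfSingularities.ResolutionOfSingularities.Theorems.PurelyInseparableDim4ResConeDInfRepresentationOf
import Summits.ResolutionOfSingularities.ResolutionOfSingularities.Theorems.PurelyInseparableDim4DInfVirtualStep
import HarnessLib
import HarnessLib.Audit.Tags

/-!
# Purely inseparable four-folds — hN4-D AS A THEOREM, HONEST FORM: the D∞ `(5,4)` tail has a pair-confined passive-free
# re-presentation (res-dim4-typ-1 g4's canonical transport F1–F4 + res-dim4-p-5 g5's entry TT and assembly), and is therefore EMPTY
# (K2(p) lane, SLICE C, hN4-D file F5; file-holder res-dim4-p-5 g5 at res-dim4-typ-1 g4's word, bus 2026-08-29T08:04:36Z)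

[OURS · counted 0 · cell `res-dim4-pi` · K2(p) lane, slice C · hN4-D SECOND ROUTE (the D∞ branch was closed FIRST by the Φ-line,
res-dim4-p-7 g5 `ResCone.no_dInf_tail_four_five` p707872; this file is the independent re-presentation route of res-dim4-typ-1's
design of record).]  Nothing here proves K2(p)/K2(5) as filed, `NoIsolatedTrap p p` or resolution of singularities in dimension ≥ 4 /
characteristic `p` — NOT proved; what is proved is, again and by a different mechanism, that OUR frame's D∞ `(5,4)` class of
hypothetical infinite chains is empty.  AI kernel work, weaker than expert review.

* **`dInf_pairConfined_representation`** — EXACTLY the hypothesis `hN4D` of `ResCone.no_dInf_tail_of_representation` (p703603), now a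
  theorem with an HONEST witness: `…DInfRepresentationOf.dInf_pairConfined_representation_of` fed with
  `SwapTransport.dInfInv_refl` (entry, π = 1) and `SwapTransport.dInf_virtual_step` (one step at every precision, coherent frames;
  res-dim4-typ-1 g4 p708052, over F1 p707299, F2 p707619, res-dim4-p-8 g5's `…UnitClassVertexSupport` p707713 / `…ReadOne` p706730),
  entry TT by `ResCone.dInf_tt` (p707227), assembly `ResCone.dInf_virtual_chain` (p708093);
* **`no_dInf_tail_of_transport`** — the D∞ branch is empty, by this route (`no_pair_tail_four_five` on the virtual chain).
[cite: CossartJannsenSaito2020, Thm. 3.10(4), Thm. 3.14] [cite: Hauser2010, §§F–G (chart expressions of a point blowup; cleaning)]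
bears_on: LADDER-RESOLUTION:D157-DOOR2 (res-dim4-pi · K2(p) = `RidgeBudget.NoAboveFloorTrap p p` · slice C, TAIL-D `(5,4)` D∞ class, hN4-D F5).
Supports stmt-ResolutionOfSingularities-16155 (helper).
-/

set_option linter.dupNamespace false -- mandated namespace of this single-conjunct summit

noncomputable section

namespace Summit.ResolutionOfSingularities.ResolutionOfSingularities.Theorems.PIDim4

namespace ResCone

open MvPolynomial Finset
open Literature.AlgebraicGeometry.Resolution
open Literature.AlgebraicGeometry.Resolution.CentreBlowup
open Literature.AlgebraicGeometry.Resolution.Hauser2010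
open Literature.AlgebraicGeometry.Resolution.HauserPerlega2019

variable {K : Type} [Field K] [CharP K 5] [DecidableEq K]

/-- **hN4-D, HONEST FORM**: every D∞ `(5,4)` tail (witnessed isolated above-floor `Step0 5` chain with `x^{r₀} ∣ F₀`, constant shade
`4`, `e_G ≡ 2`, one weight-`2` letter and `|r| ∈ {2,3}` from `k₁`) admits a PAIR-CONFINED PASSIVE-FREE re-presentation with the same
tail data — the hypothesis `hN4D` of `no_dInf_tail_of_representation`, VERBATIM, as a theorem. [OURS]
[cite: CossartJannsenSaito2020, Thm. 3.10(4), Thm. 3.14] [cite: Hauser2010, §§F–G (chart expressions of a point blowup; cleaning)] -/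
theorem dInf_pairConfined_representation :
    ∀ (c : ℕ → State K) (j : ℕ → Fin 4) (b : ℕ → Fin 4 → K),
      (∀ k, IsIsolated 5 (c k).F ∧ Step0 5 (c k) (c (k + 1))) → FreeTail.IsWitnessedChain 5 c j b →
      (∀ e ∈ (c 0).F.support, (c 0).r ≤ e) → (∀ k, ordZero (c k).F ≠ (5 : ℕ)) →
      ∀ k₀ : ℕ, (∀ k, k₀ ≤ k → (c k).shade = ((4 : ℕ) : ℕ∞)) →
      (∀ k, k₀ ≤ k → Module.finrank K (resVertex (c k)) = 2) →
      ∀ k₁ : ℕ, k₀ ≤ k₁ → (∀ k, k₁ ≤ k → (∃ W, (c k).r W = 2 ∧ ∀ i, i ≠ W → (c k).r i ≤ 1) ∧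
        (2 ≤ (c k).r.degree ∧ (c k).r.degree ≤ 3)) →
      ∃ (c' : ℕ → State K) (j' : ℕ → Fin 4) (b' : ℕ → Fin 4 → K) (k₀' : ℕ) (a a' : Fin 4),
      (∀ k, IsIsolated 5 (c' k).F ∧ Step0 5 (c' k) (c' (k + 1))) ∧ FreeTail.IsWitnessedChain 5 c' j' b' ∧
      (∀ e ∈ (c' 0).F.support, (c' 0).r ≤ e) ∧ (∀ k, ordZero (c' k).F ≠ (5 : ℕ)) ∧
      (∀ k, k₀' ≤ k → (c' k).shade = ((4 : ℕ) : ℕ∞)) ∧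
      (∀ k, k₀' ≤ k → Module.finrank K (resVertex (c' k)) = 2) ∧ a ≠ a' ∧
      (∀ k, k₀' ≤ k → (j' k = a ∨ j' k = a')) ∧
      (∀ k, k₀' ≤ k → ∀ i, i ≠ a → i ≠ a' → (c' k).r i = 0) :=
  dInf_pairConfined_representation_of
    (fun _ _ h _ hcl hrA hpair hiso he hTT => SwapTransport.dInfInv_refl h hcl hrA hpair hiso he hTT)
    (fun _ _ h => SwapTransport.dInf_virtual_step h)

/-- **THE D∞ BRANCH IS EMPTY, BY THE RE-PRESENTATION ROUTE**: the honest virtual chain of `dInf_pairConfined_representation` is a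
pair-confined passive-free shade-`4` `e_G = 2` tail, excluded by res-dim4-p-5 g4's `no_pair_tail_four_five`.  (First closed by the
Φ-line: res-dim4-p-7 g5 `no_dInf_tail_four_five` p707872; this is the independent second proof.) [OURS]
[cite: CossartJannsenSaito2020, Thm. 3.10(4), Thm. 3.14] -/
theorem no_dInf_tail_of_transport {c : ℕ → State K} {j : ℕ → Fin 4} {b : ℕ → Fin 4 → K}
    (hc : ∀ k, IsIsolated 5 (c k).F ∧ Step0 5 (c k) (c (k + 1))) (hw : FreeTail.IsWitnessedChain 5 c j b)
    (hr0 : ∀ e ∈ (c 0).F.support, (c 0).r ≤ e) (hfloor : ∀ k, ordZero (c k).F ≠ (5 : ℕ)) {k₀ : ℕ}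
    (hshade : ∀ k, k₀ ≤ k → (c k).shade = ((4 : ℕ) : ℕ∞))
    (he : ∀ k, k₀ ≤ k → Module.finrank K (resVertex (c k)) = 2) {k₁ : ℕ} (hk₁ : k₀ ≤ k₁)
    (hD : ∀ k, k₁ ≤ k → (∃ W, (c k).r W = 2 ∧ ∀ i, i ≠ W → (c k).r i ≤ 1) ∧
      (2 ≤ (c k).r.degree ∧ (c k).r.degree ≤ 3)) : False :=
  no_dInf_tail_of
    (fun _ _ h _ hcl hrA hpair hiso he hTT => SwapTransport.dInfInv_refl h hcl hrA hpair hiso he hTT)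
    (fun _ _ h => SwapTransport.dInf_virtual_step h) hc hw hr0 hfloor k₀ hshade he k₁ hk₁ hD

end ResCone

end Summit.ResolutionOfSingularities.ResolutionOfSingularities.Theorems.PIDim4

end
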